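import Summits.NavierStokesRegularity.NavierStokesRegularity.Theses.TautLoopKelvin

/-!
# Crux `TautLoopLaw` (stmt-NavierStokesRegularity-15249), line `Sketch-ideas-r1k1`:
# the Dini–Saks transfer stub is sharp — no exceptional time, and right-lsc at the initial time

Negative-side (cdisprove) lemmas on the registered stub `stub_tautLoopDiniSaks` of the picked line
(`Cruxes/TautLoopLaw/Lines/Sketch_ideas_r1k1.lean`), the pure real-analysis glue
"right-lsc on `[a,b)` + exact left-Dini step at EVERY `t ∈ (a,b]` ⇒ `f a · e^{-M} ≤ f b`".
The stub itself is true (backward real induction against an lsc Vitali–Carathéodory majorant); what is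
recorded here is that its two structural hypotheses cannot be weakened in the two ways a prover of the
hard stub `stub_tautLoopExactLevelStep` might hope for:

* `diniSaks_false_off_one_point` — requiring the left-Dini step at every time EXCEPT ONE (here the
  interior time `c = 1` of `[0, 2]`) makes the transfer FALSE, even with `Λ = Φ = 0`, `M = 0` and
  right-lsc everywhere: the downward step `f = 2` on `(-∞, 1)`, `f = 1` on `[1, ∞)` is right-lsc at every
  point, satisfies the step at every `t ≠ 1`, and has `f 0 = 2 > 1 = f 2`. So the exact-level step of the
  line must be delivered at EVERY `t ∈ (t₁, t₂]` (or an exceptional time must come with left upper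
  semicontinuity `limsup_{h↓0} ℓ(t-h) ≤ ℓ(t)` — the no-downward-jump lemma — which is what a Saks-type
  theorem with a countable exceptional set needs).
* `diniSaks_false_without_lsc_at_left_end` — requiring right-lsc only on the OPEN interval `(a, b)`
  makes the transfer FALSE: `f = 2` on `(-∞, 0]`, `f = 1` on `(0, ∞)` on `[a, b] = [0, 1]` satisfies the
  step everywhere on `(0, 1]` and right-lsc on `(0, 1)`, yet `f 0 = 2 > 1 = f 1`. For the crux this is the
  right-lsc of `t ↦ ℓ(u t, g)` AT `t₁` itself, including `t₁ = 0` where only the datum is at hand — the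
  `t = 0` clause of `stub_tautLoopSlabRegularity` (sup-norm right-continuity at `0`) is load-bearing.

Nothing here closes the item (`--supports`); no Theses statement is concluded positively.
-/

noncomputable section

open MeasureTheory Set Function Filter Real
open scoped Topology ENNReal

namespace Summit.NavierStokesRegularity.NavierStokesRegularity.Theorems.TautLoopLaw.Negative

/-! ## The two downward steps -/

/-- The downward step at `1`, open on the left: `2` on `(-∞, 1)`, `1` on `[1, ∞)`. -/
def stepOpen : ℝ → ℝ≥0∞ := fun s => if s < 1 then 2 else 1

/-- The downward step at `0`, closed on the left: `2` on `(-∞, 0]`, `1` on `(0, ∞)`. -/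
def stepClosed : ℝ → ℝ≥0∞ := fun s => if s ≤ 0 then 2 else 1

/-- Left of `1` the open step is `2`. -/
theorem stepOpen_of_lt {s : ℝ} (h : s < 1) : stepOpen s = 2 := by simp [stepOpen, h]

/-- From `1` on the open step is `1`. -/
theorem stepOpen_of_le {s : ℝ} (h : 1 ≤ s) : stepOpen s = 1 := by simp [stepOpen, not_lt.2 h]

/-- Up to `0` the closed step is `2`. -/
theorem stepClosed_of_le {s : ℝ} (h : s ≤ 0) : stepClosed s = 2 := by simp [stepClosed, h]

/-- Right of `0` the closed step is `1`. -/
theorem stepClosed_of_lt {s : ℝ} (h : 0 < s) : stepClosed s = 1 := by simp [stepClosed, not_le.2 h]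

/-- `1 ≤ ofReal (exp x)` for `0 ≤ x`. -/
theorem one_le_ofReal_exp {x : ℝ} (hx : 0 ≤ x) : (1 : ℝ≥0∞) ≤ ENNReal.ofReal (Real.exp x) :=
  ENNReal.one_le_ofReal.2 (Real.one_le_exp hx)

/-- A value is below itself times `ofReal (exp (h η))`, `h, η ≥ 0` (the trivial step of a locally
constant function). -/
theorem le_self_mul_ofReal_exp (x : ℝ≥0∞) {h η : ℝ} (hh : 0 ≤ h) (hη : 0 ≤ η) :
    x ≤ x * ENNReal.ofReal (Real.exp (h * (0 + η))) := by
  calc x = x * 1 := (mul_one x).symm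
    _ ≤ x * ENNReal.ofReal (Real.exp (h * (0 + η))) :=
        mul_le_mul_right (one_le_ofReal_exp (by positivity)) x

/-- **The open step is right-lower-semicontinuous at every point.** -/
theorem stepOpen_rightLsc (t : ℝ) : stepOpen t ≤ liminf stepOpen (𝓝[>] t) := by
  refine le_liminf_of_le (by isBoundedDefault) ?_
  by_cases ht : t < 1
  · filter_upwards [Ioo_mem_nhdsGT ht] with s hs
    rw [stepOpen_of_lt ht, stepOpen_of_lt hs.2]
  · filter_upwards [self_mem_nhdsWithin] with s hs
    rw [stepOpen_of_le (not_lt.1 ht), stepOpen_of_le ((not_lt.1 ht).trans (le_of_lt hs))]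

/-- **The open step satisfies the left-Dini step (rate `0`) at every time `t ≠ 1`.** -/
theorem stepOpen_step {t : ℝ} (ht : t ≠ 1) (η : ℝ) (hη : 0 < η) :
    ∀ᶠ h in 𝓝[>] (0 : ℝ), stepOpen (t - h) ≤ stepOpen t * ENNReal.ofReal (Real.exp (h * (0 + η))) := by
  rcases lt_or_gt_of_ne ht with hlt | hgt
  · filter_upwards [self_mem_nhdsWithin] with h hh
    have hh' : 0 < h := hh
    rw [stepOpen_of_lt (by linarith : t - h < 1), stepOpen_of_lt hlt]
    exact le_self_mul_ofReal_exp 2 hh'.le hη.le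
  · filter_upwards [Ioo_mem_nhdsGT (sub_pos.2 hgt)] with h hh
    rw [stepOpen_of_le (by linarith [hh.2] : 1 ≤ t - h), stepOpen_of_le hgt.le]
    exact le_self_mul_ofReal_exp 1 hh.1.le hη.le

/-- **The closed step is right-lower-semicontinuous at every `t > 0`** (and NOT at `0`). -/
theorem stepClosed_rightLsc {t : ℝ} (ht : 0 < t) : stepClosed t ≤ liminf stepClosed (𝓝[>] t) := by
  refine le_liminf_of_le (by isBoundedDefault) ?_
  filter_upwards [self_mem_nhdsWithin] with s hs
  rw [stepClosed_of_lt ht, stepClosed_of_lt (ht.trans hs)]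

/-- **The closed step satisfies the left-Dini step (rate `0`) at every time `t > 0`.** -/
theorem stepClosed_step {t : ℝ} (ht : 0 < t) (η : ℝ) (hη : 0 < η) :
    ∀ᶠ h in 𝓝[>] (0 : ℝ), stepClosed (t - h) ≤ stepClosed t * ENNReal.ofReal (Real.exp (h * (0 + η))) := by
  filter_upwards [Ioo_mem_nhdsGT ht] with h hh
  rw [stepClosed_of_lt (by linarith [hh.2] : 0 < t - h), stepClosed_of_lt ht]
  exact le_self_mul_ofReal_exp 1 hh.1.le hη.le

/-! ## Sharpness 1: no exceptional time for the left-Dini step -/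

/-- `stub_tautLoopDiniSaks` with the left-Dini step required at every `t ∈ (a, b]` EXCEPT ONE point `c`
(extra binder `c`, extra guard `t ≠ c`); everything else verbatim. -/
def DiniSaksOffOnePoint : Prop :=
  ∀ (f : ℝ → ENNReal) (Λ Φ : ℝ → ℝ) (a b M c : ℝ), a ≤ b → 0 ≤ M → Measurable Φ → (∀ s ∈ Set.Ioo a b, Λ s ≤ Φ s) → (∫⁻ s in Set.Ioo a b, ENNReal.ofReal (Φ s)) ≤ ENNReal.ofReal M → (∀ t ∈ Set.Ico a b, f t ≤ Filter.liminf f (nhdsWithin t (Set.Ioi t))) → (∀ t ∈ Set.Ioc a b, t ≠ c → ∀ η : ℝ, 0 < η → ∀ᶠ h in nhdsWithin (0:ℝ) (Set.Ioi 0), f (t - h) ≤ f t * ENNReal.ofReal (Real.exp (h * (Λ t + η)))) → f a * ENNReal.ofReal (Real.exp (-M)) ≤ f b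

/-- **One exceptional time breaks the Dini–Saks transfer.** Witness: the open downward step on
`[a, b] = [0, 2]` with the step waived at `c = 1`, `Λ = Φ = 0`, `M = 0`: all hypotheses hold and
`f 0 · 1 = 2 ≤ 1 = f 2` fails. -/
theorem diniSaks_false_off_one_point : ¬ DiniSaksOffOnePoint := by
  intro h
  have key := h stepOpen (fun _ => 0) (fun _ => 0) 0 2 0 1 (by norm_num) le_rfl measurable_const
    (fun _ _ => le_rfl) (by simp) (fun t _ => stepOpen_rightLsc t)
    (fun t _ htc η hη => stepOpen_step htc η hη)
  rw [stepOpen_of_lt (by norm_num : (0 : ℝ) < 1), stepOpen_of_le (by norm_num : (1 : ℝ) ≤ 2), neg_zero,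
    Real.exp_zero, ENNReal.ofReal_one, mul_one] at key
  exact absurd key (by norm_num)

/-! ## Sharpness 2: right-lsc is needed at the left end point itself -/

/-- `stub_tautLoopDiniSaks` with right-lower-semicontinuity required only on the OPEN interval
`(a, b)` (`Set.Ioo` for `Set.Ico`); everything else verbatim. -/
def DiniSaksLscInteriorOnly : Prop :=
  ∀ (f : ℝ → ENNReal) (Λ Φ : ℝ → ℝ) (a b M : ℝ), a ≤ b → 0 ≤ M → Measurable Φ → (∀ s ∈ Set.Ioo a b, Λ s ≤ Φ s) → (∫⁻ s in Set.Ioo a b, ENNReal.ofReal (Φ s)) ≤ ENNReal.ofReal M → (∀ t ∈ Set.Ioo a b, f t ≤ Filter.liminf f (nhdsWithin t (Set.Ioi t))) → (∀ t ∈ Set.Ioc a b, ∀ η : ℝ, 0 < η → ∀ᶠ h in nhdsWithin (0:ℝ) (Set.Ioi 0), f (t - h) ≤ f t * ENNReal.ofReal (Real.exp (h * (Λ t + η)))) → f a * ENNReal.ofReal (Real.exp (-M)) ≤ f b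

/-- **Right-lsc at the initial time is load-bearing.** Witness: the closed downward step on
`[a, b] = [0, 1]`, `Λ = Φ = 0`, `M = 0`: right-lsc on `(0, 1)`, the step everywhere on `(0, 1]`, and
`f 0 · 1 = 2 ≤ 1 = f 1` fails (the drop sits exactly at `a = 0`, seen only by right-lsc AT `a`). -/
theorem diniSaks_false_without_lsc_at_left_end : ¬ DiniSaksLscInteriorOnly := by
  intro h
  have key := h stepClosed (fun _ => 0) (fun _ => 0) 0 1 0 zero_le_one le_rfl measurable_const
    (fun _ _ => le_rfl) (by simp) (fun t ht => stepClosed_rightLsc ht.1)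
    (fun t ht η hη => stepClosed_step ht.1 η hη)
  rw [stepClosed_of_le le_rfl, stepClosed_of_lt one_pos, neg_zero, Real.exp_zero, ENNReal.ofReal_one,
    mul_one] at key
  exact absurd key (by norm_num)

end Summit.NavierStokesRegularity.NavierStokesRegularity.Theorems.TautLoopLaw.Negative
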